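import Summits.AtomisticToContinuum.BoseEinsteinCondensation.Theses.BECCellInformation
import Summits.AtomisticToContinuum.BoseEinsteinCondensation.Theorems.BECCellInformationCoarseChainRuleCells
import Literature.MathematicalPhysics.QuantumManyBody.SwapPurity

/-!
# Route `BECCellInformation` — support item `CoarseChainRule` (stmt-AtomisticToContinuum-13441)

Closes stmt-AtomisticToContinuum-13441: the exact signature of
`Summit.AtomisticToContinuum.BoseEinsteinCondensation.Theses.BECCellInformation.CoarseChainRule`,

  `CellInformationBound → OneBodyEntropyBound →` (coarse conditional entropy bound at scale `l`):
  `∫ dY Σ_k (m(Y)/M³) klFun(M³ A_k(Y)/m(Y)) ≤ C′` for all non-negative `δ`-near-minimisers,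

where `A_k(Y) = ∫_{cell k} |Ψ(x,Y)|² dx` (cells of side `L/M`, `M = ⌈L/l⌉₊`),
`m(Y) = ∫ |Ψ(z,Y)|² dz`, `P_k = ∫ A_k dY`.

Proof (the planner's / grounders' sketch, made junk-robust):
* pointwise in `Y` (a.e.), `Σ_k (m/M³) klFun(M³A_k/m) = Σ_k m P_k klFun(A_k/(m P_k)) + Σ_k A_k log(M³P_k)`
  (`Σ_k A_k = m` because the cells tile `[0,L)³ ⊇ Λ_L` and `Ψ` vanishes off `Λ_L`; `P_k = 0 ⇒ A_k = 0`
  a.e.), the first sum being `CellInformationBound`'s integrand;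
* `∫ dY Σ_k A_k (log M³P_k)⁺ = Σ_k P_k (log M³P_k)⁺ ≤ KL(P ‖ ū) + 1` (`-u log u ≤ 1`);
* `KL(P ‖ ū) = Σ_k M⁻³ klFun(M³P_k) ≤ ∫_Λ L⁻³ klFun(L³ P¹) ≤ max C_B 0` by Jensen (log-sum) on each
  cell for the one-body density `P¹(x) = ∫ |Ψ(x,Y)|² dY` (Fubini: `∫_{cell k} P¹ = P_k`), using
  `OneBodyEntropyBound`;
* constants: `C′ = max C_A 0 + max C_B 0 + 1`, `l := l_A`, `δ := min δ_A δ_B`, `ρ₀ := min`.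

The measure theory (integrability of `|Ψ|²` and of its slices/marginals, Tonelli/Fubini over
`ℝ³ × (ℝ³)ⁿ` via `measurePreserving_vecCons`) is in the `TrialState` section; the finite-alphabet
bookkeeping, the cell geometry and the abstract assembly are in
`BECCellInformationCoarseChainRuleCells.lean`.
-/

noncomputable section

namespace Summit.AtomisticToContinuum.BoseEinsteinCondensation.Theorems

open MeasureTheory Set InformationTheory
open scoped ENNReal
open Literature.MathematicalPhysics.QuantumManyBody.BoseGas

namespace CoarseChainRule

/-! ### The `N`-body density `|Ψ|²` of a trial state: integrability and Fubini bookkeeping -/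

section TrialState

variable {n : ℕ} {L : ℝ}

/-- `|Ψ|²` is continuous. [folklore] -/
theorem continuous_normSq (Ψ : TrialState (n + 1) L) : Continuous fun X => ‖Ψ.ψ X‖ ^ 2 :=
  (Ψ.contDiff.continuous.norm).pow 2

/-- `|Ψ|²` is integrable (the state is normalised). [folklore] -/
theorem integrable_normSq (Ψ : TrialState (n + 1) L) : Integrable (fun X => ‖Ψ.ψ X‖ ^ 2) := by
  refine ⟨(continuous_normSq Ψ).aestronglyMeasurable, ?_⟩
  have h : ∀ X, ‖‖Ψ.ψ X‖ ^ 2‖ₑ = (‖Ψ.ψ X‖₊ : ℝ≥0∞) ^ 2 := fun X => by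
    rw [Real.enorm_eq_ofReal (sq_nonneg _), ENNReal.ofReal_pow (norm_nonneg _),
      ofReal_norm, enorm_eq_nnnorm]
  simp only [HasFiniteIntegral, h, Ψ.norm_eq, ENNReal.one_lt_top]

/-- `∫ |Ψ|² = 1` as a Bochner integral. [folklore] -/
theorem integral_normSq (Ψ : TrialState (n + 1) L) : ∫ X, ‖Ψ.ψ X‖ ^ 2 = 1 := by
  rw [integral_eq_lintegral_of_nonneg_ae (ae_of_all _ fun X => sq_nonneg _)
    (continuous_normSq Ψ).aestronglyMeasurable]
  have h : ∀ X, ENNReal.ofReal (‖Ψ.ψ X‖ ^ 2) = (‖Ψ.ψ X‖₊ : ℝ≥0∞) ^ 2 := fun X => by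
    rw [ENNReal.ofReal_pow (norm_nonneg _), ofReal_norm, enorm_eq_nnnorm]
  simp only [h, Ψ.norm_eq, ENNReal.toReal_one]

/-- `(x, Y) ↦ |Ψ(x :: Y)|²` is integrable for `dx ⊗ dY`. [folklore] -/
theorem integrable_normSq_vecCons (Ψ : TrialState (n + 1) L) :
    Integrable (fun p : Space × Config n => ‖Ψ.ψ (Matrix.vecCons p.1 p.2)‖ ^ 2)
      (volume.prod volume) :=
  measurePreserving_vecCons.integrable_comp_of_integrable (integrable_normSq Ψ)

/-- `∫∫ |Ψ(x :: Y)|² dx dY = 1`. [folklore] -/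
theorem integral_normSq_vecCons_prod (Ψ : TrialState (n + 1) L) :
    ∫ p : Space × Config n, ‖Ψ.ψ (Matrix.vecCons p.1 p.2)‖ ^ 2 ∂(volume.prod volume) = 1 := by
  set e := MeasurableEquiv.piFinSuccAbove (fun _ : Fin (n + 1) => Space) 0 with he
  have hmp : MeasurePreserving e.symm (volume.prod volume) volume :=
    (volume_preserving_piFinSuccAbove (fun _ : Fin (n + 1) => Space) 0).symm
  have h := hmp.integral_comp' (fun X => ‖Ψ.ψ X‖ ^ 2)
  simp only [he, piFinSuccAbove_symm_apply_eq_vecCons] at h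
  rw [h]
  exact integral_normSq Ψ

/-- `∫ dY ∫ dx |Ψ(x :: Y)|² = 1`. [folklore] -/
theorem integral_integral_normSq_vecCons (Ψ : TrialState (n + 1) L) :
    ∫ Y : Config n, ∫ x, ‖Ψ.ψ (Matrix.vecCons x Y)‖ ^ 2 = 1 :=
  calc ∫ Y : Config n, ∫ x, ‖Ψ.ψ (Matrix.vecCons x Y)‖ ^ 2
      = ∫ p : Space × Config n, ‖Ψ.ψ (Matrix.vecCons p.1 p.2)‖ ^ 2 ∂(volume.prod volume) :=
        (integral_prod_symm _ (integrable_normSq_vecCons Ψ)).symm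
    _ = 1 := integral_normSq_vecCons_prod Ψ

/-- For a.e. `Y`, the slice `x ↦ |Ψ(x :: Y)|²` is integrable. [folklore] -/
theorem ae_integrable_normSq_vecCons (Ψ : TrialState (n + 1) L) :
    ∀ᵐ Y : Config n, Integrable (fun x : Space => ‖Ψ.ψ (Matrix.vecCons x Y)‖ ^ 2) :=
  (integrable_normSq_vecCons Ψ).prod_left_ae

/-- `(x, Y) ↦ |Ψ(x :: Y)|²` is integrable for `dx|_t ⊗ dY`. [folklore] -/
theorem integrable_normSq_vecCons_restrict_prod (Ψ : TrialState (n + 1) L) (t : Set Space) :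
    Integrable (fun p : Space × Config n => ‖Ψ.ψ (Matrix.vecCons p.1 p.2)‖ ^ 2)
      ((volume.restrict t).prod volume) :=
  (integrable_normSq_vecCons Ψ).mono_measure (Measure.prod_mono Measure.restrict_le_self le_rfl)

/-- The cell masses `Y ↦ ∫_t |Ψ(x :: Y)|² dx` are integrable in `Y`. [folklore] -/
theorem integrable_setIntegral_normSq_vecCons (Ψ : TrialState (n + 1) L) (t : Set Space) :
    Integrable (fun Y : Config n => ∫ x in t, ‖Ψ.ψ (Matrix.vecCons x Y)‖ ^ 2) :=
  (integrable_normSq_vecCons_restrict_prod Ψ t).integral_prod_right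

/-- The one-body density `x ↦ ∫ |Ψ(x :: Y)|² dY` is integrable. [folklore] -/
theorem integrable_integral_normSq_vecCons (Ψ : TrialState (n + 1) L) :
    Integrable (fun x : Space => ∫ Y : Config n, ‖Ψ.ψ (Matrix.vecCons x Y)‖ ^ 2) :=
  (integrable_normSq_vecCons Ψ).integral_prod_left

/-- Fubini: `∫ dY ∫_t dx |Ψ(x :: Y)|² = ∫_t dx ∫ dY |Ψ(x :: Y)|²`. [folklore] -/
theorem integral_setIntegral_normSq_vecCons_swap (Ψ : TrialState (n + 1) L) (t : Set Space) :
    ∫ Y : Config n, ∫ x in t, ‖Ψ.ψ (Matrix.vecCons x Y)‖ ^ 2 =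
      ∫ x in t, ∫ Y : Config n, ‖Ψ.ψ (Matrix.vecCons x Y)‖ ^ 2 :=
  integral_integral_swap (μ := volume) (ν := volume.restrict t)
    (f := fun (Y : Config n) (x : Space) => ‖Ψ.ψ (Matrix.vecCons x Y)‖ ^ 2)
    (integrable_normSq_vecCons_restrict_prod Ψ t).swap

/-- Dirichlet condition on the tagged particle: `Ψ(x :: Y) = 0` for `x ∉ Λ_L`. [folklore] -/
theorem normSq_vecCons_eq_zero (Ψ : TrialState (n + 1) L) {x : Space} (hx : x ∉ box L)
    (Y : Config n) : ‖Ψ.ψ (Matrix.vecCons x Y)‖ ^ 2 = 0 := by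
  rw [Ψ.eq_zero _ fun hX => hx (by simpa using hX 0)]
  simp

/-- For a.e. `Y`, the cell masses `A_k(Y) = ∫_{cell k} |Ψ(x :: Y)|² dx` over the cells of side
`L/M` add up to the slice mass `m(Y) = ∫ |Ψ(z :: Y)|² dz` (the cells tile `[0,L)³ ⊇ Λ_L` and `Ψ`
vanishes off `Λ_L`). [folklore] -/
theorem ae_sum_setIntegral_cell_eq (hL : 0 < L) {M : ℕ} (hM : 0 < M) (Ψ : TrialState (n + 1) L) :
    ∀ᵐ Y : Config n, ∑ k : Fin 3 → Fin M, ∫ x in {y : Space | ∀ j, y j ∈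
        Set.Ico (((k j : ℕ) : ℝ) * (L / M)) ((((k j : ℕ) : ℝ) + 1) * (L / M))},
        ‖Ψ.ψ (Matrix.vecCons x Y)‖ ^ 2 = ∫ z, ‖Ψ.ψ (Matrix.vecCons z Y)‖ ^ 2 := by
  have hs : 0 < L / M := div_pos hL (Nat.cast_pos.2 hM)
  filter_upwards [ae_integrable_normSq_vecCons Ψ] with Y hY
  rw [← integral_iUnion_fintype (fun k => measurableSet_cell _ k) (pairwise_disjoint_cell hs M)
    fun k => hY.integrableOn]
  exact setIntegral_eq_integral_of_forall_compl_eq_zero fun x hx =>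
    normSq_vecCons_eq_zero Ψ (fun hxb => hx (box_subset_iUnion_cell hL hM hxb)) Y

end TrialState

/-! ### The main estimate -/

/-- **Main estimate (fixed `N = n+1`, `L`, `M`).** If the coarse mutual information integrand of a
trial state `Ψ` at cell side `L/M` has `∫ dY ≤ C_A` and the one-body relative entropy density has
`∫_Λ dx ≤ C_B`, then the coarse conditional entropy integrand has `∫ dY ≤ max C_A 0 + max C_B 0 + 1`.
[cite: CoverThomas2005, Thm 2.5.3] -/
theorem lintegral_coarse_condEntropy_le {n : ℕ} {L : ℝ} (hL : 0 < L) {M : ℕ} (hM : 0 < M)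
    {CA CB : ℝ} (Ψ : TrialState (n + 1) L)
    (boundA : ∫⁻ Y : Config n, ENNReal.ofReal (∑ k : Fin 3 → Fin M,
      (∫ z, ‖Ψ.ψ (Matrix.vecCons z Y)‖ ^ 2) *
        (∫ Y' : Config n, ∫ x in {y : Space | ∀ j, y j ∈
          Set.Ico (((k j : ℕ) : ℝ) * (L / (M : ℝ))) ((((k j : ℕ) : ℝ) + 1) * (L / (M : ℝ)))},
          ‖Ψ.ψ (Matrix.vecCons x Y')‖ ^ 2) *
        klFun ((∫ x in {y : Space | ∀ j, y j ∈
          Set.Ico (((k j : ℕ) : ℝ) * (L / (M : ℝ))) ((((k j : ℕ) : ℝ) + 1) * (L / (M : ℝ)))},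
          ‖Ψ.ψ (Matrix.vecCons x Y)‖ ^ 2) /
          ((∫ z, ‖Ψ.ψ (Matrix.vecCons z Y)‖ ^ 2) *
            (∫ Y' : Config n, ∫ x in {y : Space | ∀ j, y j ∈
              Set.Ico (((k j : ℕ) : ℝ) * (L / (M : ℝ))) ((((k j : ℕ) : ℝ) + 1) * (L / (M : ℝ)))},
              ‖Ψ.ψ (Matrix.vecCons x Y')‖ ^ 2)))) ≤ ENNReal.ofReal CA)
    (boundB : ∫⁻ x in box L, ENNReal.ofReal ((L ^ 3)⁻¹ *
      klFun (L ^ 3 * ∫ Y' : Config n, ‖Ψ.ψ (Matrix.vecCons x Y')‖ ^ 2)) ≤ ENNReal.ofReal CB) :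
    ∫⁻ Y : Config n, ENNReal.ofReal (∑ k : Fin 3 → Fin M,
      (∫ z, ‖Ψ.ψ (Matrix.vecCons z Y)‖ ^ 2) / (M : ℝ) ^ 3 *
        klFun ((M : ℝ) ^ 3 * (∫ x in {y : Space | ∀ j, y j ∈
          Set.Ico (((k j : ℕ) : ℝ) * (L / (M : ℝ))) ((((k j : ℕ) : ℝ) + 1) * (L / (M : ℝ)))},
          ‖Ψ.ψ (Matrix.vecCons x Y)‖ ^ 2) / ∫ z, ‖Ψ.ψ (Matrix.vecCons z Y)‖ ^ 2)) ≤
      ENNReal.ofReal (max CA 0 + max CB 0 + 1) := by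
  have hMr : (0 : ℝ) < M := Nat.cast_pos.2 hM
  have hs : 0 < L / M := div_pos hL hMr
  have hKpos : 0 < (M : ℝ) ^ 3 := by positivity
  have hc : 0 < L ^ 3 := by positivity
  have hcard : (Fintype.card (Fin 3 → Fin M) : ℝ) = (M : ℝ) ^ 3 := by
    rw [Fintype.card_fun, Fintype.card_fin, Fintype.card_fin, Nat.cast_pow]
  -- the cells
  let cell : (Fin 3 → Fin M) → Set Space := fun k => {y : Space | ∀ j, y j ∈
    Set.Ico (((k j : ℕ) : ℝ) * (L / (M : ℝ))) ((((k j : ℕ) : ℝ) + 1) * (L / (M : ℝ)))}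
  have hcm : ∀ k, MeasurableSet (cell k) := fun k => measurableSet_cell (L / M) k
  have hdisj : Pairwise (Function.onFun Disjoint cell) := pairwise_disjoint_cell hs M
  have hvol : ∀ k, volume.real (cell k) = L ^ 3 / (M : ℝ) ^ 3 := fun k => by
    rw [measureReal_def, show volume (cell k) = ENNReal.ofReal ((L / M) ^ 3) from
      volume_cell hs.le k, ENNReal.toReal_ofReal (by positivity), div_pow]
  have hUae : (⋃ k, cell k) =ᵐ[volume] box L := iUnion_cell_ae_eq_box hL hM
  -- the cell masses `A_k(Y)`, slice mass `m(Y)` and cell law `P_k`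
  have hA0 : ∀ k (Y : Config n), 0 ≤ ∫ x in cell k, ‖Ψ.ψ (Matrix.vecCons x Y)‖ ^ 2 :=
    fun k Y => integral_nonneg fun x => sq_nonneg _
  have hAi : ∀ k, Integrable (fun Y : Config n => ∫ x in cell k, ‖Ψ.ψ (Matrix.vecCons x Y)‖ ^ 2) :=
    fun k => integrable_setIntegral_normSq_vecCons Ψ (cell k)
  have hsumA : ∀ᵐ Y : Config n, ∑ k, ∫ x in cell k, ‖Ψ.ψ (Matrix.vecCons x Y)‖ ^ 2 =
      ∫ z, ‖Ψ.ψ (Matrix.vecCons z Y)‖ ^ 2 := ae_sum_setIntegral_cell_eq hL hM Ψ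
  have hsumP : ∑ k, ∫ Y : Config n, ∫ x in cell k, ‖Ψ.ψ (Matrix.vecCons x Y)‖ ^ 2 = 1 := by
    rw [← integral_finsetSum _ fun k _ => hAi k, integral_congr_ae hsumA]
    exact integral_integral_normSq_vecCons Ψ
  -- the one-body density `g` and its relative entropy density
  let g : Space → ℝ := fun x => ∫ Y : Config n, ‖Ψ.ψ (Matrix.vecCons x Y)‖ ^ 2
  have hg0 : ∀ x, 0 ≤ g x := fun x => integral_nonneg fun Y => sq_nonneg _
  have hgi : Integrable g := integrable_integral_normSq_vecCons Ψ
  have hIB0 : ∀ x, 0 ≤ (L ^ 3)⁻¹ * klFun (L ^ 3 * g x) := fun x =>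
    mul_nonneg (inv_nonneg.2 hc.le) (klFun_nonneg (mul_nonneg hc.le (hg0 x)))
  have hIBm : AEStronglyMeasurable (fun x => (L ^ 3)⁻¹ * klFun (L ^ 3 * g x)) volume :=
    (continuous_klFun.comp_aestronglyMeasurable (hgi.aestronglyMeasurable.const_mul _)).const_mul _
  have hIBbox : IntegrableOn (fun x => (L ^ 3)⁻¹ * klFun (L ^ 3 * g x)) (box L) :=
    ⟨hIBm.restrict, (hasFiniteIntegral_iff_ofReal (ae_of_all _ hIB0)).2
      (boundB.trans_lt ENNReal.ofReal_lt_top)⟩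
  have hIBle : ∫ x in box L, (L ^ 3)⁻¹ * klFun (L ^ 3 * g x) ≤ max CB 0 := by
    rw [integral_eq_lintegral_of_nonneg_ae (ae_of_all _ hIB0) hIBm.restrict,
      ← ENNReal.toReal_ofReal']
    exact ENNReal.toReal_mono ENNReal.ofReal_ne_top boundB
  have hP : ∀ k, ∫ Y : Config n, ∫ x in cell k, ‖Ψ.ψ (Matrix.vecCons x Y)‖ ^ 2 =
      ∫ x in cell k, g x := fun k => integral_setIntegral_normSq_vecCons_swap Ψ (cell k)
  have boundKL : ∑ k, ((M : ℝ) ^ 3)⁻¹ *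
      klFun ((M : ℝ) ^ 3 * ∫ Y : Config n, ∫ x in cell k, ‖Ψ.ψ (Matrix.vecCons x Y)‖ ^ 2) ≤
      max CB 0 := by
    simp only [hP]
    calc ∑ k, ((M : ℝ) ^ 3)⁻¹ * klFun ((M : ℝ) ^ 3 * ∫ x in cell k, g x)
        ≤ ∫ x in ⋃ k, cell k, (L ^ 3)⁻¹ * klFun (L ^ 3 * g x) :=
          sum_inv_mul_klFun_le_setIntegral hcm hdisj hKpos hc hvol hg0 hgi
            (hIBbox.congr_set_ae hUae)
      _ = ∫ x in box L, (L ^ 3)⁻¹ * klFun (L ^ 3 * g x) := setIntegral_congr_set hUae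
      _ ≤ max CB 0 := hIBle
  exact lintegral_ofReal_sum_coarse_le (μ := volume) hcard hKpos
    (m := fun Y : Config n => ∫ z, ‖Ψ.ψ (Matrix.vecCons z Y)‖ ^ 2)
    (A := fun k (Y : Config n) => ∫ x in cell k, ‖Ψ.ψ (Matrix.vecCons x Y)‖ ^ 2)
    (P := fun k => ∫ Y : Config n, ∫ x in cell k, ‖Ψ.ψ (Matrix.vecCons x Y)‖ ^ 2)
    hA0 hAi (fun k => rfl) hsumA hsumP boundA (le_max_right _ _) boundKL

end CoarseChainRule

/-- **`CoarseChainRule` (route `BECCellInformation`, stmt-AtomisticToContinuum-13441).**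
`CellInformationBound → OneBodyEntropyBound →` the coarse conditional entropy bound
`E_Y KL(Q_l(·|Y) ‖ ū_l) ≤ C′` at the cell side `l` of `CellInformationBound`, with
`C′ = max C_A 0 + max C_B 0 + 1`, `δ = min δ_A δ_B`, `ρ₀ = min`. Pointwise in `Y` the coarse
integrand splits exactly into the mutual-information integrand plus `Σ_k A_k log(M³P_k)`; the
`dY`-integral of the positive part of the latter is at most `KL(P‖ū) + 1`, and
`KL(P‖ū) ≤ KL(P¹‖u_Λ) ≤ max C_B 0` by the log-sum inequality per cell.
[cite: CoverThomas2005, Thm 2.5.3 and Thm 2.7.1] -/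
theorem coarseChainRule_proof :
    Summit.AtomisticToContinuum.BoseEinsteinCondensation.Theses.BECCellInformation.CoarseChainRule := by
  intro hA hB v hv
  obtain ⟨ρA, hρA, HA⟩ := hA v hv
  obtain ⟨ρB, hρB, HB⟩ := hB v hv
  refine ⟨min ρA ρB, lt_min hρA hρB, fun ρ hρ hρlt => ?_⟩
  obtain ⟨l, hl, CA, hevA⟩ := HA ρ hρ (hρlt.trans_le (min_le_left _ _))
  obtain ⟨CB, hevB⟩ := HB ρ hρ (hρlt.trans_le (min_le_right _ _))
  refine ⟨l, hl, max CA 0 + max CB 0 + 1, ?_⟩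
  filter_upwards [hevA, hevB] with n hnA hnB
  obtain ⟨δA, hδA, hΨA⟩ := hnA
  obtain ⟨δB, hδB, hΨB⟩ := hnB
  refine ⟨min δA δB, lt_min hδA hδB, fun Ψ hE hpos => ?_⟩
  have hL : 0 < sideLength ρ (n + 1) := by
    unfold sideLength
    exact Real.rpow_pos_of_pos (div_pos (Nat.cast_pos.2 n.succ_pos) hρ) _
  have hM : 0 < ⌈sideLength ρ (n + 1) / l⌉₊ := Nat.ceil_pos.2 (div_pos hL hl)
  exact CoarseChainRule.lintegral_coarse_condEntropy_le hL hM Ψ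
    (hΨA Ψ (hE.trans (add_le_add_right (min_le_left _ _) _)) hpos)
    (hΨB Ψ (hE.trans (add_le_add_right (min_le_right _ _) _)))

end Summit.AtomisticToContinuum.BoseEinsteinCondensation.Theorems

end
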